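import Summits.CriticalPhenomena.PercolationContinuityZ3.Theorems.PercNearOneGluingNoHeavyLowerTailSunflowerVertexFibre

/-!
# Seven-slot endpoint lemmas for the W-priced certificate: the root-ordered product, and the `y = k` edges by convexity

(prove-1 gen 57, memo run/shared/lean/prim/prim-ineq-prove-1/FINDING-VERTEX-prove1-g57.md §3.)  With the face `W = {w=1}` priced as a
seventh budget, every fibre of the petal polytope except the `y = k` edges is still root-ordered (`affine_le_prod7_rpow_of_endpoints`, the
6-slot lemma with one more slot).  On a `y = k` edge the W-usage `a + Bt` has the slope of `G = A + Bt` but a larger intercept; there the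
defect `log(A + Bt) − Λ·log t − l·log(a + Bt)` is CONVEX in `log t` as soon as the single inequality `l·a·(A + Bt₁)² ≤ A·(a + Bt₁)²` holds at
the right endpoint (`affine_le_yk_core`, via `MonotoneOn.convexOn_of_deriv`), so the endpoint values still decide
(`affine_le_prod7_yk_of_endpoints`, same slot interface: slots 1,2,5 pure powers, 3,4,6 constant, 7 = W). [this work]
-/

namespace Summit.CriticalPhenomena.PercolationContinuityZ3.Theorems.SunflowerPartition.SafeCalc.LinkedCurrency

/-- Monotonicity of a seven-fold product with a nonnegative constant in front. [this work] -/
theorem mul7_le_mul7 {C x₁ x₂ x₃ x₄ x₅ x₆ x₇ y₁ y₂ y₃ y₄ y₅ y₆ y₇ : ℝ} (hC : 0 ≤ C)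
    (h₁ : 0 ≤ x₁) (h₂ : 0 ≤ x₂) (h₃ : 0 ≤ x₃) (h₄ : 0 ≤ x₄) (h₅ : 0 ≤ x₅) (h₆ : 0 ≤ x₆) (h₇ : 0 ≤ x₇)
    (e₁ : x₁ ≤ y₁) (e₂ : x₂ ≤ y₂) (e₃ : x₃ ≤ y₃) (e₄ : x₄ ≤ y₄) (e₅ : x₅ ≤ y₅) (e₆ : x₆ ≤ y₆) (e₇ : x₇ ≤ y₇) :
    C * x₁ * x₂ * x₃ * x₄ * x₅ * x₆ * x₇ ≤ C * y₁ * y₂ * y₃ * y₄ * y₅ * y₆ * y₇ := by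
  have h := mul6_le_mul6 hC h₁ h₂ h₃ h₄ h₅ h₆ e₁ e₂ e₃ e₄ e₅ e₆
  have g : 0 ≤ C * y₁ * y₂ * y₃ * y₄ * y₅ * y₆ :=
    mul_nonneg (mul_nonneg (mul_nonneg (mul_nonneg (mul_nonneg (mul_nonneg hC (h₁.trans e₁)) (h₂.trans e₂)) (h₃.trans e₃))
      (h₄.trans e₄)) (h₅.trans e₅)) (h₆.trans e₆)
  exact mul_le_mul h e₇ h₇ g

/-- `(C x₁ ⋯ x₇)^w = C^w x₁^w ⋯ x₇^w` for nonnegative reals. [this work] -/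
theorem rpow_mul8 {C x₁ x₂ x₃ x₄ x₅ x₆ x₇ w : ℝ} (hC : 0 ≤ C)
    (h₁ : 0 ≤ x₁) (h₂ : 0 ≤ x₂) (h₃ : 0 ≤ x₃) (h₄ : 0 ≤ x₄) (h₅ : 0 ≤ x₅) (h₆ : 0 ≤ x₆) (h₇ : 0 ≤ x₇) :
    (C * x₁ * x₂ * x₃ * x₄ * x₅ * x₆ * x₇) ^ w = C ^ w * x₁ ^ w * x₂ ^ w * x₃ ^ w * x₄ ^ w * x₅ ^ w * x₆ ^ w * x₇ ^ w := by
  have n6 : 0 ≤ C * x₁ * x₂ * x₃ * x₄ * x₅ * x₆ :=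
    mul_nonneg (mul_nonneg (mul_nonneg (mul_nonneg (mul_nonneg (mul_nonneg hC h₁) h₂) h₃) h₄) h₅) h₆
  rw [Real.mul_rpow n6 h₇, rpow_mul7 hC h₁ h₂ h₃ h₄ h₅ h₆]

set_option maxHeartbeats 400000 in
/-- **Root-ordered endpoint lemma, seven slots** (as `affine_le_prod6_rpow_of_endpoints` with one more slot). [this work] -/
theorem affine_le_prod7_rpow_of_endpoints
    {A B C t₀ t₁ t a₁ b₁ f₁ l₁ a₂ b₂ f₂ l₂ a₃ b₃ f₃ l₃ a₄ b₄ f₄ l₄ a₅ b₅ f₅ l₅ a₆ b₆ f₆ l₆ a₇ b₇ f₇ l₇ : ℝ}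
    (hA : 0 ≤ A) (hB : 0 < B) (hC : 0 ≤ C) (ht₀ : 0 < t₀) (h₀ : t₀ ≤ t) (h₁ : t ≤ t₁)
    (hb₁ : 0 ≤ b₁) (hf₁ : 0 < f₁) (hl₁ : 0 ≤ l₁) (hp₁ : 0 < b₁ * t₀ + a₁) (hr₁ : b₁ = 0 ∨ a₁ * B ≤ A * b₁)
    (hb₂ : 0 ≤ b₂) (hf₂ : 0 < f₂) (hl₂ : 0 ≤ l₂) (hp₂ : 0 < b₂ * t₀ + a₂) (hr₂ : b₂ = 0 ∨ a₂ * B ≤ A * b₂)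
    (hb₃ : 0 ≤ b₃) (hf₃ : 0 < f₃) (hl₃ : 0 ≤ l₃) (hp₃ : 0 < b₃ * t₀ + a₃) (hr₃ : b₃ = 0 ∨ a₃ * B ≤ A * b₃)
    (hb₄ : 0 ≤ b₄) (hf₄ : 0 < f₄) (hl₄ : 0 ≤ l₄) (hp₄ : 0 < b₄ * t₀ + a₄) (hr₄ : b₄ = 0 ∨ a₄ * B ≤ A * b₄)
    (hb₅ : 0 ≤ b₅) (hf₅ : 0 < f₅) (hl₅ : 0 ≤ l₅) (hp₅ : 0 < b₅ * t₀ + a₅) (hr₅ : b₅ = 0 ∨ a₅ * B ≤ A * b₅)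
    (hb₆ : 0 ≤ b₆) (hf₆ : 0 < f₆) (hl₆ : 0 ≤ l₆) (hp₆ : 0 < b₆ * t₀ + a₆) (hr₆ : b₆ = 0 ∨ a₆ * B ≤ A * b₆)
    (hb₇ : 0 ≤ b₇) (hf₇ : 0 < f₇) (hl₇ : 0 ≤ l₇) (hp₇ : 0 < b₇ * t₀ + a₇) (hr₇ : b₇ = 0 ∨ a₇ * B ≤ A * b₇)
    (e₀ : A + B * t₀ ≤ C * ((b₁ * t₀ + a₁) / f₁) ^ l₁ * ((b₂ * t₀ + a₂) / f₂) ^ l₂ * ((b₃ * t₀ + a₃) / f₃) ^ l₃ *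
      ((b₄ * t₀ + a₄) / f₄) ^ l₄ * ((b₅ * t₀ + a₅) / f₅) ^ l₅ * ((b₆ * t₀ + a₆) / f₆) ^ l₆ * ((b₇ * t₀ + a₇) / f₇) ^ l₇)
    (e₁ : A + B * t₁ ≤ C * ((b₁ * t₁ + a₁) / f₁) ^ l₁ * ((b₂ * t₁ + a₂) / f₂) ^ l₂ * ((b₃ * t₁ + a₃) / f₃) ^ l₃ *
      ((b₄ * t₁ + a₄) / f₄) ^ l₄ * ((b₅ * t₁ + a₅) / f₅) ^ l₅ * ((b₆ * t₁ + a₆) / f₆) ^ l₆ * ((b₇ * t₁ + a₇) / f₇) ^ l₇) :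
    A + B * t ≤ C * ((b₁ * t + a₁) / f₁) ^ l₁ * ((b₂ * t + a₂) / f₂) ^ l₂ * ((b₃ * t + a₃) / f₃) ^ l₃ *
      ((b₄ * t + a₄) / f₄) ^ l₄ * ((b₅ * t + a₅) / f₅) ^ l₅ * ((b₆ * t + a₆) / f₆) ^ l₆ * ((b₇ * t + a₇) / f₇) ^ l₇ := by
  rcases eq_or_lt_of_le (h₀.trans h₁) with heq | hlt
  · have : t = t₀ := le_antisymm (heq ▸ h₁) h₀
    rw [this]; exact e₀
  have hG0 : 0 < A + B * t₀ := add_pos_of_nonneg_of_pos hA (mul_pos hB ht₀)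
  have ht : 0 < t := lt_of_lt_of_le ht₀ h₀
  have hG1 : 0 < A + B * t₁ := add_pos_of_nonneg_of_pos hA (mul_pos hB (lt_of_lt_of_le ht h₁))
  have hG01 : A + B * t₀ < A + B * t₁ := by nlinarith
  obtain ⟨wa, wb, hwa, hwb, hw, hG⟩ :=
    exists_gm_weights hG0 hG01 (by nlinarith : A + B * t₀ ≤ A + B * t) (by nlinarith : A + B * t ≤ A + B * t₁)
  have s₁ := slot_gm_le hB h₀ h₁ hwa hwb hw hG0 hG hb₁ hf₁ hl₁ hp₁ hr₁
  have s₂ := slot_gm_le hB h₀ h₁ hwa hwb hw hG0 hG hb₂ hf₂ hl₂ hp₂ hr₂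
  have s₃ := slot_gm_le hB h₀ h₁ hwa hwb hw hG0 hG hb₃ hf₃ hl₃ hp₃ hr₃
  have s₄ := slot_gm_le hB h₀ h₁ hwa hwb hw hG0 hG hb₄ hf₄ hl₄ hp₄ hr₄
  have s₅ := slot_gm_le hB h₀ h₁ hwa hwb hw hG0 hG hb₅ hf₅ hl₅ hp₅ hr₅
  have s₆ := slot_gm_le hB h₀ h₁ hwa hwb hw hG0 hG hb₆ hf₆ hl₆ hp₆ hr₆
  have s₇ := slot_gm_le hB h₀ h₁ hwa hwb hw hG0 hG hb₇ hf₇ hl₇ hp₇ hr₇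
  have h01 : t₀ ≤ t₁ := h₀.trans h₁
  have n1 : 0 ≤ ((b₁ * t₀ + a₁) / f₁) ^ l₁ := slot_nonneg hb₁ hf₁ hp₁ (le_refl t₀)
  have n2 : 0 ≤ ((b₂ * t₀ + a₂) / f₂) ^ l₂ := slot_nonneg hb₂ hf₂ hp₂ (le_refl t₀)
  have n3 : 0 ≤ ((b₃ * t₀ + a₃) / f₃) ^ l₃ := slot_nonneg hb₃ hf₃ hp₃ (le_refl t₀)
  have n4 : 0 ≤ ((b₄ * t₀ + a₄) / f₄) ^ l₄ := slot_nonneg hb₄ hf₄ hp₄ (le_refl t₀)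
  have n5 : 0 ≤ ((b₅ * t₀ + a₅) / f₅) ^ l₅ := slot_nonneg hb₅ hf₅ hp₅ (le_refl t₀)
  have n6 : 0 ≤ ((b₆ * t₀ + a₆) / f₆) ^ l₆ := slot_nonneg hb₆ hf₆ hp₆ (le_refl t₀)
  have n7 : 0 ≤ ((b₇ * t₀ + a₇) / f₇) ^ l₇ := slot_nonneg hb₇ hf₇ hp₇ (le_refl t₀)
  have m1 : 0 ≤ ((b₁ * t₁ + a₁) / f₁) ^ l₁ := slot_nonneg hb₁ hf₁ hp₁ h01
  have m2 : 0 ≤ ((b₂ * t₁ + a₂) / f₂) ^ l₂ := slot_nonneg hb₂ hf₂ hp₂ h01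
  have m3 : 0 ≤ ((b₃ * t₁ + a₃) / f₃) ^ l₃ := slot_nonneg hb₃ hf₃ hp₃ h01
  have m4 : 0 ≤ ((b₄ * t₁ + a₄) / f₄) ^ l₄ := slot_nonneg hb₄ hf₄ hp₄ h01
  have m5 : 0 ≤ ((b₅ * t₁ + a₅) / f₅) ^ l₅ := slot_nonneg hb₅ hf₅ hp₅ h01
  have m6 : 0 ≤ ((b₆ * t₁ + a₆) / f₆) ^ l₆ := slot_nonneg hb₆ hf₆ hp₆ h01
  have m7 : 0 ≤ ((b₇ * t₁ + a₇) / f₇) ^ l₇ := slot_nonneg hb₇ hf₇ hp₇ h01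
  have hR0 : 0 ≤ C * ((b₁ * t₀ + a₁) / f₁) ^ l₁ * ((b₂ * t₀ + a₂) / f₂) ^ l₂ * ((b₃ * t₀ + a₃) / f₃) ^ l₃ *
      ((b₄ * t₀ + a₄) / f₄) ^ l₄ * ((b₅ * t₀ + a₅) / f₅) ^ l₅ * ((b₆ * t₀ + a₆) / f₆) ^ l₆ * ((b₇ * t₀ + a₇) / f₇) ^ l₇ :=
    mul_nonneg (mul_nonneg (mul_nonneg (mul_nonneg (mul_nonneg (mul_nonneg (mul_nonneg hC n1) n2) n3) n4) n5) n6) n7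
  set X1 := ((b₁ * t₀ + a₁) / f₁) ^ l₁ with hX1
  set X2 := ((b₂ * t₀ + a₂) / f₂) ^ l₂ with hX2
  set X3 := ((b₃ * t₀ + a₃) / f₃) ^ l₃ with hX3
  set X4 := ((b₄ * t₀ + a₄) / f₄) ^ l₄ with hX4
  set X5 := ((b₅ * t₀ + a₅) / f₅) ^ l₅ with hX5
  set X6 := ((b₆ * t₀ + a₆) / f₆) ^ l₆ with hX6
  set X7 := ((b₇ * t₀ + a₇) / f₇) ^ l₇ with hX7
  set Y1 := ((b₁ * t₁ + a₁) / f₁) ^ l₁ with hY1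
  set Y2 := ((b₂ * t₁ + a₂) / f₂) ^ l₂ with hY2
  set Y3 := ((b₃ * t₁ + a₃) / f₃) ^ l₃ with hY3
  set Y4 := ((b₄ * t₁ + a₄) / f₄) ^ l₄ with hY4
  set Y5 := ((b₅ * t₁ + a₅) / f₅) ^ l₅ with hY5
  set Y6 := ((b₆ * t₁ + a₆) / f₆) ^ l₆ with hY6
  set Y7 := ((b₇ * t₁ + a₇) / f₇) ^ l₇ with hY7
  have step2 : A + B * t ≤ (C * X1 * X2 * X3 * X4 * X5 * X6 * X7) ^ wa * (C * Y1 * Y2 * Y3 * Y4 * Y5 * Y6 * Y7) ^ wb := by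
    rw [← hG]
    exact mul_le_mul (Real.rpow_le_rpow hG0.le e₀ hwa) (Real.rpow_le_rpow hG1.le e₁ hwb) (Real.rpow_nonneg hG1.le _)
      (Real.rpow_nonneg hR0 _)
  have hCw : C ^ wa * C ^ wb = C := by rw [← Real.rpow_add' hC (by rw [hw]; norm_num), hw, Real.rpow_one]
  rw [rpow_mul8 hC n1 n2 n3 n4 n5 n6 n7, rpow_mul8 hC m1 m2 m3 m4 m5 m6 m7] at step2
  have step3 : C ^ wa * X1 ^ wa * X2 ^ wa * X3 ^ wa * X4 ^ wa * X5 ^ wa * X6 ^ wa * X7 ^ wa *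
      (C ^ wb * Y1 ^ wb * Y2 ^ wb * Y3 ^ wb * Y4 ^ wb * Y5 ^ wb * Y6 ^ wb * Y7 ^ wb)
      = (C ^ wa * C ^ wb) * (X1 ^ wa * Y1 ^ wb) * (X2 ^ wa * Y2 ^ wb) * (X3 ^ wa * Y3 ^ wb) * (X4 ^ wa * Y4 ^ wb) *
          (X5 ^ wa * Y5 ^ wb) * (X6 ^ wa * Y6 ^ wb) * (X7 ^ wa * Y7 ^ wb) := by ring
  rw [step3, hCw] at step2
  refine step2.trans ?_
  exact mul7_le_mul7 hC (mul_nonneg (Real.rpow_nonneg n1 _) (Real.rpow_nonneg m1 _))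
    (mul_nonneg (Real.rpow_nonneg n2 _) (Real.rpow_nonneg m2 _)) (mul_nonneg (Real.rpow_nonneg n3 _) (Real.rpow_nonneg m3 _))
    (mul_nonneg (Real.rpow_nonneg n4 _) (Real.rpow_nonneg m4 _)) (mul_nonneg (Real.rpow_nonneg n5 _) (Real.rpow_nonneg m5 _))
    (mul_nonneg (Real.rpow_nonneg n6 _) (Real.rpow_nonneg m6 _)) (mul_nonneg (Real.rpow_nonneg n7 _) (Real.rpow_nonneg m7 _))
    s₁ s₂ s₃ s₄ s₅ s₆ s₇

/-- The convexity bracket on a `y = k` edge: under `l a (A + Bt₁)² ≤ A (a + Bt₁)²` (`A ≤ a`), for `t ≤ t' ≤ t₁`: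
`l·a·(A+Bt)(A+Bt') ≤ A·(a+Bt)(a+Bt')`. [this work] -/
theorem yk_bracket {A B a l t t' t₁ : ℝ} (hA : 0 < A) (hB : 0 < B) (hAa : A ≤ a) (hl : 0 ≤ l) (ht : 0 < t)
    (htt' : t ≤ t') (ht'1 : t' ≤ t₁) (row : l * a * (A + B * t₁) ^ 2 ≤ A * (a + B * t₁) ^ 2) :
    l * a * ((A + B * t) * (A + B * t')) ≤ A * ((a + B * t) * (a + B * t')) := by
  have ha : 0 < a := lt_of_lt_of_le hA hAa
  have ht' : 0 < t' := lt_of_lt_of_le ht htt'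
  have hP : 0 < A + B * t := by positivity
  have hP' : 0 < A + B * t' := by positivity
  have hQ1 : 0 < a + B * t₁ := add_pos_of_pos_of_nonneg ha (mul_nonneg hB.le (ht'.le.trans ht'1))
  -- (A + Bt)(a + Bt₁) ≤ (A + Bt₁)(a + Bt), and the same for t'
  have r1 : (A + B * t) * (a + B * t₁) ≤ (A + B * t₁) * (a + B * t) := by
    nlinarith [mul_nonneg (mul_nonneg hB.le (sub_nonneg.2 (htt'.trans ht'1))) (sub_nonneg.2 hAa)]
  have r2 : (A + B * t') * (a + B * t₁) ≤ (A + B * t₁) * (a + B * t') := by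
    nlinarith [mul_nonneg (mul_nonneg hB.le (sub_nonneg.2 ht'1)) (sub_nonneg.2 hAa)]
  have r12 : (A + B * t) * (A + B * t') * (a + B * t₁) ^ 2 ≤ (A + B * t₁) ^ 2 * ((a + B * t) * (a + B * t')) := by
    have := mul_le_mul r1 r2 (mul_nonneg hP'.le hQ1.le) (mul_nonneg (hP.le.trans (by nlinarith [r1])) (by positivity))
    nlinarith [this]
  have hla : 0 ≤ l * a := mul_nonneg hl ha.le
  have key : l * a * ((A + B * t) * (A + B * t')) * (a + B * t₁) ^ 2 ≤ A * ((a + B * t) * (a + B * t')) * (a + B * t₁) ^ 2 :=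
    calc l * a * ((A + B * t) * (A + B * t')) * (a + B * t₁) ^ 2
        = l * a * ((A + B * t) * (A + B * t') * (a + B * t₁) ^ 2) := by ring
      _ ≤ l * a * ((A + B * t₁) ^ 2 * ((a + B * t) * (a + B * t'))) := mul_le_mul_of_nonneg_left r12 hla
      _ = (l * a * (A + B * t₁) ^ 2) * ((a + B * t) * (a + B * t')) := by ring
      _ ≤ (A * (a + B * t₁) ^ 2) * ((a + B * t) * (a + B * t')) := mul_le_mul_of_nonneg_right row (by positivity)
      _ = A * ((a + B * t) * (a + B * t')) * (a + B * t₁) ^ 2 := by ring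
  exact le_of_mul_le_mul_right key (by positivity)

/-- **The `y = k` edge with W priced.**  `A + Bt ≤ K t^Λ (a + Bt)^l` on `[t₀, t₁]` from the two endpoints, when `A ≤ a` and
`l a (A + Bt₁)² ≤ A (a + Bt₁)²` (convexity of the defect in `log t`). [this work] -/
theorem affine_le_yk_core {A B K Λ l a t₀ t₁ t : ℝ} (hA : 0 < A) (hB : 0 < B) (hK : 0 < K) (hl : 0 ≤ l)
    (hAa : A ≤ a) (ht₀ : 0 < t₀) (h₀ : t₀ ≤ t) (h₁ : t ≤ t₁)
    (row : l * a * (A + B * t₁) ^ 2 ≤ A * (a + B * t₁) ^ 2)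
    (e₀ : A + B * t₀ ≤ K * t₀ ^ Λ * (a + B * t₀) ^ l) (e₁ : A + B * t₁ ≤ K * t₁ ^ Λ * (a + B * t₁) ^ l) :
    A + B * t ≤ K * t ^ Λ * (a + B * t) ^ l := by
  have ha : 0 < a := lt_of_lt_of_le hA hAa
  have ht : 0 < t := lt_of_lt_of_le ht₀ h₀
  have ht₁ : 0 < t₁ := lt_of_lt_of_le ht h₁
  -- the defect as a function of u = log t
  set f : ℝ → ℝ := fun u => Real.log (A + B * Real.exp u) - l * Real.log (a + B * Real.exp u) - Λ * u - Real.log K with hf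
  -- f (log x) ≤ 0 ↔ the inequality at x
  have hiff : ∀ x : ℝ, 0 < x → (f (Real.log x) ≤ 0 ↔ A + B * x ≤ K * x ^ Λ * (a + B * x) ^ l) := by
    intro x hx
    have hPx : 0 < A + B * x := by positivity
    have hQx : 0 < a + B * x := by positivity
    have hR : 0 < K * x ^ Λ * (a + B * x) ^ l := by positivity
    simp only [hf, Real.exp_log hx]
    rw [← Real.log_le_log_iff hPx hR, Real.log_mul (by positivity) (by positivity), Real.log_mul hK.ne' (by positivity),
      Real.log_rpow hx, Real.log_rpow hQx]
    constructor <;> intro h <;> linarith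
  -- derivative
  have hd : ∀ u : ℝ, HasDerivAt f (B * Real.exp u / (A + B * Real.exp u) - l * (B * Real.exp u / (a + B * Real.exp u)) - Λ) u := by
    intro u
    have hE := Real.hasDerivAt_exp u
    have hPu : A + B * Real.exp u ≠ 0 := ne_of_gt (by positivity)
    have hQu : a + B * Real.exp u ≠ 0 := ne_of_gt (by positivity)
    have h1 : HasDerivAt (fun x => Real.log (A + B * Real.exp x)) (B * Real.exp u / (A + B * Real.exp u)) u := by
      have := ((hE.const_mul B).const_add A).log hPu
      simpa using this
    have h2 : HasDerivAt (fun x => l * Real.log (a + B * Real.exp x)) (l * (B * Real.exp u / (a + B * Real.exp u))) u := by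
      have := (((hE.const_mul B).const_add a).log hQu).const_mul l
      simpa using this
    have h3 : HasDerivAt (fun x => Λ * x) Λ u := by simpa using (hasDerivAt_id u).const_mul Λ
    have h12 : HasDerivAt (fun x => Real.log (A + B * Real.exp x) - l * Real.log (a + B * Real.exp x))
        (B * Real.exp u / (A + B * Real.exp u) - l * (B * Real.exp u / (a + B * Real.exp u))) u := h1.sub h2
    have h123 : HasDerivAt (fun x => Real.log (A + B * Real.exp x) - l * Real.log (a + B * Real.exp x) - Λ * x)
        (B * Real.exp u / (A + B * Real.exp u) - l * (B * Real.exp u / (a + B * Real.exp u)) - Λ) u := h12.sub h3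
    have h := h123.sub_const (Real.log K)
    rw [hf]
    exact h
  -- convexity on [log t₀, log t₁]
  have hconv : ConvexOn ℝ (Set.Icc (Real.log t₀) (Real.log t₁)) f := by
    apply MonotoneOn.convexOn_of_deriv (convex_Icc _ _)
    · exact fun u _ => (hd u).continuousAt.continuousWithinAt
    · exact fun u _ => (hd u).differentiableAt.differentiableWithinAt
    · intro u hu u' hu' huu'
      rw [interior_Icc] at hu hu'
      rw [(hd u).deriv, (hd u').deriv]
      have hx : 0 < Real.exp u := Real.exp_pos u
      have hxx' : Real.exp u ≤ Real.exp u' := Real.exp_le_exp.2 huu'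
      have hx'1 : Real.exp u' ≤ t₁ := by
        have := Real.exp_le_exp.2 hu'.2.le
        rwa [Real.exp_log ht₁] at this
      have key := yk_bracket hA hB hAa hl hx hxx' hx'1 row
      have hP : 0 < A + B * Real.exp u := by positivity
      have hP' : 0 < A + B * Real.exp u' := by positivity
      have hQ : 0 < a + B * Real.exp u := by positivity
      have hQ' : 0 < a + B * Real.exp u' := by positivity
      rw [← sub_nonneg]
      have e : B * Real.exp u' / (A + B * Real.exp u') - l * (B * Real.exp u' / (a + B * Real.exp u')) - Λ -
          (B * Real.exp u / (A + B * Real.exp u) - l * (B * Real.exp u / (a + B * Real.exp u)) - Λ) =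
          B * (Real.exp u' - Real.exp u) * (A * ((a + B * Real.exp u) * (a + B * Real.exp u')) -
            l * a * ((A + B * Real.exp u) * (A + B * Real.exp u'))) /
          ((A + B * Real.exp u) * (A + B * Real.exp u') * ((a + B * Real.exp u) * (a + B * Real.exp u'))) := by
        field_simp
        ring
      rw [e]
      apply div_nonneg _ (by positivity)
      exact mul_nonneg (mul_nonneg hB.le (sub_nonneg.2 hxx')) (sub_nonneg.2 key)
  -- endpoint values and the conclusion
  have hl₀ : Real.log t₀ ≤ Real.log t := Real.log_le_log ht₀ h₀
  have hl₁ : Real.log t ≤ Real.log t₁ := Real.log_le_log ht h₁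
  have hmem : Real.log t ∈ segment ℝ (Real.log t₀) (Real.log t₁) := by
    rw [segment_eq_Icc (hl₀.trans hl₁)]; exact ⟨hl₀, hl₁⟩
  have hmax := hconv.le_on_segment (Set.left_mem_Icc.2 (hl₀.trans hl₁)) (Set.right_mem_Icc.2 (hl₀.trans hl₁)) hmem
  have f0 : f (Real.log t₀) ≤ 0 := (hiff t₀ ht₀).2 e₀
  have f1 : f (Real.log t₁) ≤ 0 := (hiff t₁ ht₁).2 e₁
  exact (hiff t ht).1 (hmax.trans (max_le f0 f1))

/-- **Seven-slot endpoint lemma for a `y = k` edge** (slots 1, 2, 5 pure powers of `t`, slots 3, 4, 6 constant, slot 7 = W with the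
slope of `G` and an intercept `a₇ ≥ A`): the endpoint inequalities plus the convexity row imply the inequality on `[t₀, t₁]`. [this work] -/
theorem affine_le_prod7_yk_of_endpoints
    {A B C t₀ t₁ t b₁ f₁ l₁ b₂ f₂ l₂ a₃ f₃ l₃ a₄ f₄ l₄ b₅ f₅ l₅ a₆ f₆ l₆ a₇ f₇ l₇ : ℝ}
    (hA : 0 < A) (hB : 0 < B) (hC : 0 < C) (ht₀ : 0 < t₀) (h₀ : t₀ ≤ t) (h₁ : t ≤ t₁)
    (hb₁ : 0 < b₁) (hf₁ : 0 < f₁) (hb₂ : 0 < b₂) (hf₂ : 0 < f₂) (ha₃ : 0 < a₃) (hf₃ : 0 < f₃) (ha₄ : 0 < a₄) (hf₄ : 0 < f₄)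
    (hb₅ : 0 < b₅) (hf₅ : 0 < f₅) (ha₆ : 0 < a₆) (hf₆ : 0 < f₆) (hAa : A ≤ a₇) (hf₇ : 0 < f₇) (hl₇ : 0 ≤ l₇)
    (row : l₇ * a₇ * (A + B * t₁) ^ 2 ≤ A * (a₇ + B * t₁) ^ 2)
    (e₀ : A + B * t₀ ≤ C * ((b₁ * t₀ + 0) / f₁) ^ l₁ * ((b₂ * t₀ + 0) / f₂) ^ l₂ * ((0 * t₀ + a₃) / f₃) ^ l₃ *
      ((0 * t₀ + a₄) / f₄) ^ l₄ * ((b₅ * t₀ + 0) / f₅) ^ l₅ * ((0 * t₀ + a₆) / f₆) ^ l₆ * ((B * t₀ + a₇) / f₇) ^ l₇)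
    (e₁ : A + B * t₁ ≤ C * ((b₁ * t₁ + 0) / f₁) ^ l₁ * ((b₂ * t₁ + 0) / f₂) ^ l₂ * ((0 * t₁ + a₃) / f₃) ^ l₃ *
      ((0 * t₁ + a₄) / f₄) ^ l₄ * ((b₅ * t₁ + 0) / f₅) ^ l₅ * ((0 * t₁ + a₆) / f₆) ^ l₆ * ((B * t₁ + a₇) / f₇) ^ l₇) :
    A + B * t ≤ C * ((b₁ * t + 0) / f₁) ^ l₁ * ((b₂ * t + 0) / f₂) ^ l₂ * ((0 * t + a₃) / f₃) ^ l₃ *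
      ((0 * t + a₄) / f₄) ^ l₄ * ((b₅ * t + 0) / f₅) ^ l₅ * ((0 * t + a₆) / f₆) ^ l₆ * ((B * t + a₇) / f₇) ^ l₇ := by
  have ha₇ : 0 < a₇ := lt_of_lt_of_le hA hAa
  -- collect the constant
  set K := C * (b₁ / f₁) ^ l₁ * (b₂ / f₂) ^ l₂ * (a₃ / f₃) ^ l₃ * (a₄ / f₄) ^ l₄ * (b₅ / f₅) ^ l₅ * (a₆ / f₆) ^ l₆ *
    (1 / f₇) ^ l₇ with hK
  have hKpos : 0 < K := by rw [hK]; positivity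
  have key : ∀ x : ℝ, 0 < x →
      C * ((b₁ * x + 0) / f₁) ^ l₁ * ((b₂ * x + 0) / f₂) ^ l₂ * ((0 * x + a₃) / f₃) ^ l₃ * ((0 * x + a₄) / f₄) ^ l₄ *
        ((b₅ * x + 0) / f₅) ^ l₅ * ((0 * x + a₆) / f₆) ^ l₆ * ((B * x + a₇) / f₇) ^ l₇ =
      K * x ^ (l₁ + l₂ + l₅) * (a₇ + B * x) ^ l₇ := by
    intro x hx
    have e1 : ((b₁ * x + 0) / f₁) ^ l₁ = (b₁ / f₁) ^ l₁ * x ^ l₁ := by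
      rw [add_zero, show b₁ * x / f₁ = b₁ / f₁ * x by ring, Real.mul_rpow (div_nonneg hb₁.le hf₁.le) hx.le]
    have e2 : ((b₂ * x + 0) / f₂) ^ l₂ = (b₂ / f₂) ^ l₂ * x ^ l₂ := by
      rw [add_zero, show b₂ * x / f₂ = b₂ / f₂ * x by ring, Real.mul_rpow (div_nonneg hb₂.le hf₂.le) hx.le]
    have e5 : ((b₅ * x + 0) / f₅) ^ l₅ = (b₅ / f₅) ^ l₅ * x ^ l₅ := by
      rw [add_zero, show b₅ * x / f₅ = b₅ / f₅ * x by ring, Real.mul_rpow (div_nonneg hb₅.le hf₅.le) hx.le]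
    have e7 : ((B * x + a₇) / f₇) ^ l₇ = (1 / f₇) ^ l₇ * (a₇ + B * x) ^ l₇ := by
      rw [show (B * x + a₇) / f₇ = 1 / f₇ * (a₇ + B * x) by ring, Real.mul_rpow (div_nonneg zero_le_one hf₇.le) (by positivity)]
    rw [e1, e2, e5, e7]
    simp only [zero_mul, zero_add]
    rw [Real.rpow_add hx, Real.rpow_add hx, hK]
    ring
  rw [key t₀ ht₀] at e₀
  rw [key t₁ (lt_of_lt_of_le (lt_of_lt_of_le ht₀ h₀) h₁)] at e₁
  rw [key t (lt_of_lt_of_le ht₀ h₀)]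
  exact affine_le_yk_core hA hB hKpos hl₇ hAa ht₀ h₀ h₁ row e₀ e₁

end Summit.CriticalPhenomena.PercolationContinuityZ3.Theorems.SunflowerPartition.SafeCalc.LinkedCurrency
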